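import Literature.MeasureTheory.Group.InvariantQuotientExistence     -- ★ `fiberIntegral`, `continuous_fiberIntegral`, `isCompact_fiberSupportBound`
import HarnessLib

/-!
# Harish-Chandra's cut-off along a closed subgroup: `β ∈ C_c(G)`, `β ≥ 0`, with `∫_M β(x k) dk = 1` for all `x` in a prescribed `C·M`, `C` compact
(Harish-Chandra (notes by van Dijk), *Harmonic Analysis on Reductive p-adic Groups*, LNM 162 (1970), Part I §3, proof of Lemma 19; cf. Bourbaki, *Intégration* VII §2 no. 4)

Topic `MeasureTheory/Group`; namespace `Literature.MeasureTheory.Group`.  THEOREMS ONLY (no definition, no named fact, no instance, no notation, no `sorry`).  Cell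
`pub/hodgecm-mathlib` (D-0151), crux H413 = stmt-HodgeConjecture-24833, floor-2 line «N6nsGerm», binder `hD` of ★ `exists_nhds_stableOrbitalIntegralRel_eq_of_central_singular_inv`
(F0P3a-p08's (R-inv) junction, p841647) — brick **B4-meas FILE M1** (LEAD F0P3a-plan (g9) T8-88 register); seat F0P3a-p08 (g13).  HONEST LABEL: HC_CM is proved only modulo the printed
citations until rung 0 closes; this file is generic measure theory on locally compact groups and proves no letter.

THE MATHEMATICS.  `G` a locally compact second countable Hausdorff group, `M ≤ G` a closed subgroup with a left Haar measure `ρ`, `C ⊆ G` compact.  Choose `β₀ ∈ C_c(G)`,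
`0 ≤ β₀ ≤ 1`, `β₀ = 1` on `C` (Urysohn); its FIBRE INTEGRAL `B(x) = ∫_M β₀(x k) dρ(k)` (★ `fiberIntegral`, continuous by ★ `continuous_fiberIntegral`, right-`M`-invariant) is `> 0` on `C`
(the fibre `k ↦ β₀(x k)` is a non-zero continuous non-negative compactly supported function on `M`), hence `≥ δ := min_C B > 0` on `C·M`; then
`β := β₀ ∕ max(B, δ)` is continuous, compactly supported, non-negative, and `∫_M β(x k) dρ(k) = B(x)∕B(x) = 1` for `x ∈ C·M`.  This is the cut-off of Harish-Chandra's descent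
`ψ ↦ ψ_M(m) = ∫_G β(x) ψ(x m x⁻¹) dx` (FILE M2 `OrbitalDescentCentralizer`).

* `fiberIntegral_mul_right_mem` (right-`M`-invariance of the fibre integral), `fiberIntegral_pos_of_eq_one` (positivity at `C`),
  **`exists_continuous_hasCompactSupport_fiberIntegral_eq_one`** (the cut-off).

## References
* [HarishChandra1970] Harish-Chandra (notes by G. van Dijk), *Harmonic Analysis on Reductive p-adic Groups*, LNM 162 (1970), Part I §3 (proof of Lemma 19: the function `β`).
* [DeitmarEchterhoff2014] A. Deitmar, S. Echterhoff, *Principles of Harmonic Analysis*, 2nd ed. (2014), Lemma 1.5.1 (the fibre integral `f^H`).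
-/

set_option autoImplicit false

noncomputable section

open MeasureTheory MeasureTheory.Measure Topology Set Filter Function
open scoped Pointwise

namespace Literature.MeasureTheory.Group

section Cutoff

variable {G : Type*} [Group G] [TopologicalSpace G] [IsTopologicalGroup G] [LocallyCompactSpace G] [SecondCountableTopology G] [T2Space G]
  (M : Subgroup G) (hM : IsClosed (M : Set G)) [MeasurableSpace M] [BorelSpace M]
  (ρ : Measure M) [ρ.IsMulLeftInvariant] [IsFiniteMeasureOnCompacts ρ]

omit [LocallyCompactSpace G] [SecondCountableTopology G] [T2Space G] [IsFiniteMeasureOnCompacts ρ] in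
/-- **Right-`M`-invariance of the fibre integral**: `∫_M f(x k h) dρ(h) = ∫_M f(x h) dρ(h)` for `k ∈ M` (left invariance of `ρ`).
[cite: DeitmarEchterhoff2014, Lemma 1.5.1] -/
theorem integral_comp_mul_mul_coe_eq (f : G → ℝ) (x : G) (k : M) :
    ∫ h : M, f (x * (k : G) * (h : G)) ∂ρ = ∫ h : M, f (x * (h : G)) ∂ρ := by
  have key := integral_mul_left_eq_self (μ := ρ) (fun h : M => f (x * (h : G))) k
  simpa only [Subgroup.coe_mul, mul_assoc] using key

omit [LocallyCompactSpace G] [SecondCountableTopology G] [T2Space G] [MeasurableSpace M] [BorelSpace M] in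
include hM in
/-- The fibre `k ↦ f(x k)` of a compactly supported `f` on the CLOSED subgroup `M` is compactly supported. [cite: DeitmarEchterhoff2014, Lemma 1.5.1] -/
theorem hasCompactSupport_comp_mul_coe {f : G → ℝ} (hfs : HasCompactSupport f) (x : G) : HasCompactSupport fun h : M => f (x * (h : G)) := by
  refine HasCompactSupport.of_support_subset_isCompact (isCompact_fiberSupportBound M hM (isCompact_singleton (x := x)) hfs.isCompact) ?_
  intro h hh
  rw [Function.mem_support] at hh
  refine ⟨x⁻¹, Set.inv_mem_inv.2 (Set.mem_singleton x), x * (h : G), subset_tsupport _ (Function.mem_support.2 hh), ?_⟩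
  simp

omit [LocallyCompactSpace G] [SecondCountableTopology G] [T2Space G] [ρ.IsMulLeftInvariant] in
include hM in
/-- **Positivity of the fibre integral**: if `f ∈ C_c(G)` is non-negative with `f(x) = 1`, then `∫_M f(x k) dρ(k) > 0` (for a left Haar measure `ρ` on `M`, positive on
open sets). [cite: HarishChandra1970, Part I §3] -/
theorem integral_comp_mul_coe_pos [ρ.IsOpenPosMeasure] {f : G → ℝ} (hf : Continuous f) (hfs : HasCompactSupport f) (hf0 : ∀ g, 0 ≤ f g) {x : G} (hx : f x = 1) :
    0 < ∫ h : M, f (x * (h : G)) ∂ρ := by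
  refine Continuous.integral_pos_of_hasCompactSupport_nonneg_nonzero (x := (1 : M)) (hf.comp (continuous_const.mul continuous_subtype_val))
    (hasCompactSupport_comp_mul_coe M hM hfs x) (fun h => hf0 _) ?_
  simp only [OneMemClass.coe_one, mul_one, hx]
  exact one_ne_zero

include hM in
/-- **HARISH-CHANDRA'S CUT-OFF.**  `M ≤ G` closed with a left Haar measure `ρ` (positive on open sets, finite on compacts), `C ⊆ G` compact: there is `β : G → ℝ` continuous, compactly
supported, non-negative, with `∫_M β(x k) dρ(k) = 1` for every `x ∈ C·M` (stated: every `x = c k₀`, `c ∈ C`, `k₀ ∈ M`).  Construction: `β := β₀ ∕ max(B, δ)` with `β₀` a Urysohn function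
`= 1` on `C`, `B` its fibre integral and `δ = min_C B > 0`. [cite: HarishChandra1970, Part I §3 (proof of Lemma 19)] -/
theorem exists_continuous_hasCompactSupport_integral_comp_mul_eq_one [ρ.IsOpenPosMeasure] {C : Set G} (hC : IsCompact C) :
    ∃ β : G → ℝ, Continuous β ∧ HasCompactSupport β ∧ (∀ g, 0 ≤ β g) ∧
      ∀ c ∈ C, ∀ k₀ : M, ∫ h : M, β (c * (k₀ : G) * (h : G)) ∂ρ = 1 := by
  classical
  -- Urysohn: `β₀ ∈ C_c(G)`, `0 ≤ β₀ ≤ 1`, `β₀ = 1` on `C`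
  obtain ⟨β₀, hβ₀C, -, hβ₀s, hβ₀01⟩ := exists_continuous_one_zero_of_isCompact hC isClosed_empty (Set.disjoint_empty C)
  have hβ₀c : Continuous (β₀ : G → ℝ) := β₀.continuous
  have hβ₀0 : ∀ g, 0 ≤ (β₀ : G → ℝ) g := fun g => (hβ₀01 g).1
  -- the fibre integral `B(x) = ∫_M β₀(x k) dρ(k)`
  set B : G → ℝ := fun x => ∫ h : M, (β₀ : G → ℝ) (x * (h : G)) ∂ρ with hBdef
  have hBc : Continuous B := by
    have h := continuous_fiberIntegral M ρ hM hβ₀c hβ₀s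
    have hB' : B = fiberIntegral M ρ (β₀ : G → ℝ) ∘ (QuotientGroup.mk : G → G ⧸ M) := by
      funext x; simp only [hBdef, Function.comp_apply, fiberIntegral_mk]
    rw [hB']
    exact h.comp continuous_quot_mk
  have hBk : ∀ (x : G) (k : M), B (x * (k : G)) = B x := fun x k => integral_comp_mul_mul_coe_eq M ρ (β₀ : G → ℝ) x k
  have hBpos : ∀ c ∈ C, 0 < B c := fun c hc => integral_comp_mul_coe_pos M hM ρ hβ₀c hβ₀s hβ₀0 (hβ₀C hc)
  -- `δ := min_C B > 0` (or `1` when `C = ∅`)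
  obtain ⟨δ, hδ, hδB⟩ : ∃ δ : ℝ, 0 < δ ∧ ∀ c ∈ C, δ ≤ B c := by
    rcases C.eq_empty_or_nonempty with hCe | hCne
    · exact ⟨1, one_pos, fun c hc => by rw [hCe] at hc; exact absurd hc (Set.notMem_empty c)⟩
    · obtain ⟨c₀, hc₀, hmin⟩ := hC.exists_isMinOn hCne hBc.continuousOn
      exact ⟨B c₀, hBpos c₀ hc₀, fun c hc => hmin hc⟩
  -- the cut-off
  refine ⟨fun g => (β₀ : G → ℝ) g / max (B g) δ, ?_, ?_, ?_, ?_⟩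
  · exact hβ₀c.div (hBc.max continuous_const) fun g => (lt_max_of_lt_right hδ).ne'
  · refine hβ₀s.mono fun g hg => ?_
    rw [Function.mem_support] at hg ⊢
    intro h0
    exact hg (by rw [h0, zero_div])
  · exact fun g => div_nonneg (hβ₀0 g) ((hδ.le).trans (le_max_right _ _))
  · intro c hc k₀
    have hmax : ∀ h : M, max (B (c * (k₀ : G) * (h : G))) δ = B c := by
      intro h
      rw [mul_assoc, ← Subgroup.coe_mul, hBk, max_eq_left (hδB c hc)]
    simp_rw [hmax]
    rw [integral_div, integral_comp_mul_mul_coe_eq M ρ (β₀ : G → ℝ) c k₀]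
    exact div_self (hBpos c hc).ne'

end Cutoff

end Literature.MeasureTheory.Group

end
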